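import Literature.NumberTheory.EllipticCurves.HeegnerPointsKolyvaginDescentProofs
import Summits.BirchSwinnertonDyer.BirchSwinnertonDyer.Theorems.GoldfeldAllTwistsTwoConverseTwinHalfTraceSevenModEightCore
import Mathlib.GroupTheory.OrderOfElement
import HarnessLib

/-!
# Route `GenusKolyvaginAtTwo`, LINE 18 (L_T `PowDvdShaCardAtTwoRT`, stmt-BirchSwinnertonDyer-23659), road (E4) — THE ALGEBRA OF
# «rank E(K) ≤ 1 from Kolyvagin's two exponent laws at 2» (P-reduction of the capstone: `PubInputsAtTwo` is used only as rank ≤ 1)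

Seat `bsd-line-gk2-p4` g21 (WIDTH-5 attach, cell `bsd-f1-sign2`), `--supports stmt-BirchSwinnertonDyer-23659` (helper; closes nothing).
THEOREMS ONLY (no definition, no named fact, no `sorry`); pure algebra of abelian groups.  BSD is not proved by any of this.

WHY.  Road (E4)'s K-side capstone (gk2-p2 p737814; P-free form `…RTOrthogonalCapstoneRankLeOne`) needs exactly one arithmetic input beyond
L_T's frame: `rank_ℤ E(K) ≤ 1` (Kolyvagin's theorem, rank half).  Kolyvagin's descent at `2` supplies two EXPONENT laws on `Sel_{2^M}(E/K)`
for the complex conjugation `τ` (`ε₀ = −w(E)` the sign of `δ y_K`; one bit lost per local pairing is harmless here): (B) an eigenclass of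
sign `−ε₀` has `ord s · ord δ_M y_K ∣ 2^{M+1}`; (A) an eigenclass of sign `ε₀` whose cyclic group is DISJOINT from a carrier `⟨q⟩ ∋ δ_M y_K`
has the same bound.  This file is the algebra turning (A) + (B) into the rank bound:
* `exists_sub_zsmul_disjoint_zmultiples` (§1) — in an abelian group killed by `2^M`, against an element `q` of maximal order `2^M` every
  `s` has a translate `s − m•q` whose cyclic group meets `⟨q⟩` trivially;
* `finrank_le_one_of_zsmul_map_mem_zmultiples` (§2) — if `δ : A →+ V` has kernel `2^M A` on a finitely generated `A` without `2`-torsion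
  and `2^c • δ(A)` lies in one cyclic group `⟨g⟩` with `2^M • g = 0` and `2c < M`, then `rank_ℤ A ≤ 1` (Gross 1991 §2,
  `pow_finrank_dvd_natCard_quotient_range_zsmul`, applied to `A′ = 2^c A ≅ A`: `A′/2^{M−c}A′ ↪ ⟨g⟩`, so `2^{(M−c)·r} ∣ 2^M`);
* `zsmul_mem_zmultiples_of_exponent_laws` (§3) — (A) + (B) ⟹ `2^{c+1} • Sel ⊆ ⟨q⟩` (`2v = (v + ετv) + (v − ετv)`, §1 on the first summand).
The arithmetic (laws (A), (B) on L_T's habitat from Q2 + Q5R + the tree's local eigen-duality law) and the assembly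
`rank E(K) ≤ 1` are the sequel files `…RTRankDescent*`.

References: [GrossLMS1991] §2 (sentence after (2.2)), §10; [McCallumLMS1991] §5; [Kolyvagin1990] Thm. A; [SilvermanAEC2009] VIII.§2.
-/

set_option autoImplicit false
-- the Theorems namespace of this sub repeats the summit name by design (D-0017 nested layout)
set_option linter.dupNamespace false

namespace Summit.BirchSwinnertonDyer.BirchSwinnertonDyer.Theorems.GenusExact.PlusDescent

open AddSubgroup

/-! ## §1 Disjointification against an element of maximal order -/

section Disjoint

variable {V : Type*} [AddCommGroup V]

/-- In an abelian group killed by `2^M`, an odd integer acts invertibly: if `n` is odd and `n • x ∈ H` for a subgroup `H`, then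
`x ∈ H`. [folklore] -/
theorem mem_of_odd_zsmul_mem {M : ℕ} (hV : ∀ v : V, ((2 ^ M : ℕ) : ℤ) • v = 0) (H : AddSubgroup V) {n : ℤ} (hn : Odd n)
    {x : V} (hx : n • x ∈ H) : x ∈ H := by
  have hcopN : Nat.Coprime n.natAbs (2 ^ M) :=
    Nat.Coprime.pow_right M (Nat.coprime_two_right.mpr (Int.natAbs_odd.mpr hn))
  have hcop : IsCoprime n ((2 ^ M : ℕ) : ℤ) := by
    rw [Int.isCoprime_iff_gcd_eq_one, Int.gcd_eq_natAbs]
    simpa using hcopN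
  obtain ⟨u, v, huv⟩ := hcop
  have : x = u • (n • x) + v • (((2 ^ M : ℕ) : ℤ) • x) := by
    rw [smul_smul, smul_smul, ← add_smul, huv, one_smul]
  rw [this, hV, smul_zero, add_zero]
  exact H.zsmul_mem hx u

end Disjoint

section Disjoint2

variable {V : Type*} [AddCommGroup V]

/-- In an abelian group killed by `2^M`: if `n • x ∈ H` with `n = 2^e · n'`, `n'` odd, then `2^e • x ∈ H`. [folklore] -/
theorem two_pow_zsmul_mem_of_zsmul_mem {M : ℕ} (hV : ∀ v : V, ((2 ^ M : ℕ) : ℤ) • v = 0) (H : AddSubgroup V)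
    {x : V} {e : ℕ} {n' : ℤ} (hn' : Odd n') (hx : (2 ^ e * n') • x ∈ H) : ((2 ^ e : ℕ) : ℤ) • x ∈ H := by
  rw [mul_comm, mul_smul] at hx
  have h := mem_of_odd_zsmul_mem hV H hn' hx
  exact_mod_cast h

/-- **Disjointification against an element of maximal order.**  In an abelian group `V` killed by `2^M`, let `q` have the maximal
order `2^M`.  Then every `s ∈ V` has a translate `s − m • q` (`m ∈ ℤ`) whose cyclic subgroup meets `⟨q⟩` trivially.  (If `2^b • s = k • q`
with `b` least, write `k = 2^{b'} k'` with `k'` odd; maximality of `ord q` forces `b ≤ b'`, and `m = 2^{b'−b} k'` works.) [folklore] -/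
theorem exists_sub_zsmul_disjoint_zmultiples {M : ℕ} (hV : ∀ v : V, ((2 ^ M : ℕ) : ℤ) • v = 0)
    {q : V} (hq : addOrderOf q = 2 ^ M) (s : V) :
    ∃ m : ℤ, Disjoint (zmultiples (s - m • q)) (zmultiples q) := by
  classical
  have hex : ∃ b : ℕ, ((2 ^ b : ℕ) : ℤ) • s ∈ zmultiples q := ⟨M, by rw [hV]; exact zero_mem _⟩
  obtain ⟨hbs, hmin⟩ : ((2 ^ Nat.find hex : ℕ) : ℤ) • s ∈ zmultiples q ∧
      ∀ b' < Nat.find hex, ((2 ^ b' : ℕ) : ℤ) • s ∉ zmultiples q :=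
    ⟨Nat.find_spec hex, fun b' hb' ↦ Nat.find_min hex hb'⟩
  set b := Nat.find hex with hb
  have hbM : b ≤ M := Nat.find_le (by rw [hV]; exact zero_mem _)
  -- the general principle: `n • x ∈ ⟨q⟩` with `x = s - m • q` and `2^b • x = 0` forces `n • x = 0`
  have key : ∀ (m : ℤ), ((2 ^ b : ℕ) : ℤ) • (s - m • q) = 0 →
      Disjoint (zmultiples (s - m • q)) (zmultiples q) := by
    intro m hm0
    rw [disjoint_iff_inf_le]
    rintro x ⟨hx1, hx2⟩
    obtain ⟨n, rfl⟩ := mem_zmultiples_iff.mp hx1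
    rw [mem_bot]
    by_cases hn : n = 0
    · rw [hn, zero_smul]
    obtain ⟨e, n', hn', rfl⟩ := GoldfeldGoodTwists.int_exists_eq_two_pow_mul_odd hn
    -- `n • s ∈ ⟨q⟩`, hence `2^e • s ∈ ⟨q⟩`, hence `b ≤ e`
    have hns : (2 ^ e * n') • s ∈ zmultiples q := by
      have : (2 ^ e * n') • (s - m • q) + (2 ^ e * n' * m) • q = (2 ^ e * n') • s := by
        rw [smul_sub, mul_smul (2 ^ e * n') m q]; abel
      rw [← this]
      exact add_mem hx2 (zsmul_mem (mem_zmultiples q) _)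
    have hes : ((2 ^ e : ℕ) : ℤ) • s ∈ zmultiples q := two_pow_zsmul_mem_of_zsmul_mem hV _ hn' hns
    have hbe : b ≤ e := by
      by_contra h
      exact hmin e (by omega) hes
    -- so `n • (s - m q) = n' • 2^{e-b} • 2^b • (s - m q) = 0`
    have : (2 : ℤ) ^ e * n' = n' * 2 ^ (e - b) * ((2 ^ b : ℕ) : ℤ) := by
      push_cast
      rw [mul_assoc, ← pow_add, Nat.sub_add_cancel hbe, mul_comm]
    rw [this, mul_smul, hm0, smul_zero]
  obtain ⟨k, hk⟩ := mem_zmultiples_iff.mp hbs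
  by_cases hk0 : k • q = 0
  · refine ⟨0, key 0 ?_⟩
    rw [zero_smul, sub_zero, ← hk, hk0]
  have hkne : k ≠ 0 := by
    rintro rfl
    exact hk0 (zero_smul _ _)
  obtain ⟨b', k', hk', rfl⟩ := GoldfeldGoodTwists.int_exists_eq_two_pow_mul_odd hkne
  -- maximality of `ord q`: `b ≤ b'`
  have hbb' : b ≤ b' := by
    -- `2^(M-b) • 2^b • s = 0`, so `2^(M-b+b') k' • q = 0`, so `2^(M-b+b') • q = 0`, so `2^M ∣ 2^(M-b+b')`
    have h1 : ((2 : ℤ) ^ (M - b) * (2 ^ b' * k')) • q = 0 := by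
      rw [mul_smul, hk, smul_smul]
      have : (2 : ℤ) ^ (M - b) * ((2 ^ b : ℕ) : ℤ) = ((2 ^ M : ℕ) : ℤ) := by
        push_cast
        rw [← pow_add, Nat.sub_add_cancel hbM]
      rw [this, hV]
    have h2 : ((2 ^ (M - b + b') : ℕ) : ℤ) • q ∈ (⊥ : AddSubgroup V) := by
      refine two_pow_zsmul_mem_of_zsmul_mem hV ⊥ hk' ?_
      rw [mem_bot, ← h1]
      congr 1
      ring
    rw [mem_bot, natCast_zsmul, ← addOrderOf_dvd_iff_nsmul_eq_zero, hq] at h2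
    have h3 : M ≤ M - b + b' := (Nat.pow_dvd_pow_iff_le_right (by norm_num)).mp h2
    omega
  refine ⟨2 ^ (b' - b) * k', key _ ?_⟩
  rw [smul_sub, ← hk, smul_smul, sub_eq_zero]
  congr 1
  push_cast
  rw [← mul_assoc, ← pow_add, Nat.add_sub_cancel' hbb']

end Disjoint2

/-! ## §2 Rank at most one from a cyclic bound on `2^c • δ(A)` -/

section Rank

variable {A V : Type*} [AddCommGroup A] [AddCommGroup V]

/-- No `2`-torsion ⟹ no `2^c`-torsion. [folklore] -/
theorem eq_zero_of_two_pow_zsmul_eq_zero (h2 : ∀ a : A, (2 : ℤ) • a = 0 → a = 0) (c : ℕ) {a : A}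
    (ha : ((2 ^ c : ℕ) : ℤ) • a = 0) : a = 0 := by
  induction c generalizing a with
  | zero => simpa using ha
  | succ c ih =>
    apply ih
    apply h2
    rw [smul_smul]
    have : (2 : ℤ) * ((2 ^ c : ℕ) : ℤ) = ((2 ^ (c + 1) : ℕ) : ℤ) := by push_cast; ring
    rw [this, ha]

/-- **Rank at most one from Kolyvagin's exponent laws (the algebra).**  Let `A` be a finitely generated abelian group without
`2`-torsion, `δ : A →+ V` a homomorphism with kernel EXACTLY `2^M A` (the Kummer map modulo `2^M`), and suppose that `2^c • δ(A)`
lies in a single cyclic subgroup `⟨g⟩` with `2^M • g = 0`, where `2c < M`.  Then `rank_ℤ A ≤ 1`.  Proof: `A′ = 2^c A ≅ A` has the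
same rank `r`; `δ|_{A′}` has kernel `A′ ∩ 2^M A = 2^{M−c} A′` and image inside `⟨g⟩`, so `#(A′/2^{M−c}A′) ∣ #⟨g⟩ ∣ 2^M`, while
`2^{(M−c)r} ∣ #(A′/2^{M−c}A′)` (Gross 1991 §2, `pow_finrank_dvd_natCard_quotient_range_zsmul`); hence `(M−c)·r ≤ M < 2(M−c)`.
[cite: GrossLMS1991, §2 (sentence after (2.2))] -/
theorem finrank_le_one_of_zsmul_map_mem_zmultiples [Module.Finite ℤ A]
    (h2 : ∀ a : A, (2 : ℤ) • a = 0 → a = 0) (δ : A →+ V) {M c : ℕ} (hcM : 2 * c < M)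
    (hker : δ.ker = (zsmulAddGroupHom (α := A) ((2 ^ M : ℕ) : ℤ)).range)
    (g : V) (hg : ((2 ^ M : ℕ) : ℤ) • g = 0)
    (hcyc : ∀ a : A, ((2 ^ c : ℕ) : ℤ) • δ a ∈ zmultiples g) :
    Module.finrank ℤ A ≤ 1 := by
  classical
  -- `f = 2^c •` is injective, so `A′ = 2^c A ≅ A`
  set f : A →ₗ[ℤ] A := LinearMap.lsmul ℤ A ((2 ^ c : ℕ) : ℤ) with hf
  have hfapply : ∀ a, f a = ((2 ^ c : ℕ) : ℤ) • a := fun a ↦ rfl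
  have hinj : Function.Injective f := by
    rw [injective_iff_map_eq_zero]
    intro a ha
    exact eq_zero_of_two_pow_zsmul_eq_zero h2 c (by rw [← hfapply, ha])
  set A' : Submodule ℤ A := LinearMap.range f with hA'
  have e : A ≃ₗ[ℤ] A' := LinearEquiv.ofInjective f hinj
  haveI : Module.Finite ℤ A' := Module.Finite.equiv e
  have hrank : Module.finrank ℤ A' = Module.finrank ℤ A := e.finrank_eq.symm
  -- Gross §2 for `A′` and `2^(M-c)`
  haveI : NeZero (2 ^ (M - c)) := ⟨pow_ne_zero _ two_ne_zero⟩
  have hdvd := Literature.NumberTheory.EllipticCurves.pow_finrank_dvd_natCard_quotient_range_zsmul (A := A') (2 ^ (M - c))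
  rw [hrank] at hdvd
  -- `δ′ = δ|_{A′}` : kernel `2^(M-c) A′`, image inside `⟨g⟩`
  set δ' : A' →+ V := δ.comp A'.toAddSubgroup.subtype with hδ'
  have hδ'apply : ∀ x : A', δ' x = δ (x : A) := fun x ↦ rfl
  have hkerδ' : δ'.ker = (zsmulAddGroupHom (α := A') ((2 ^ (M - c) : ℕ) : ℤ)).range := by
    ext x
    rw [AddMonoidHom.mem_ker, hδ'apply, AddMonoidHom.mem_range]
    obtain ⟨a, ha⟩ : ∃ a, f a = (x : A) := LinearMap.mem_range.mp x.2
    constructor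
    · intro hx
      have hx' : (x : A) ∈ δ.ker := (AddMonoidHom.mem_ker).mpr hx
      rw [hker, AddMonoidHom.mem_range] at hx'
      obtain ⟨z, hz⟩ := hx'
      -- `2^c a = 2^M z = 2^c (2^(M-c) z)`, so `a = 2^(M-c) z`
      have hpow : ((2 ^ M : ℕ) : ℤ) = ((2 ^ c : ℕ) : ℤ) * ((2 ^ (M - c) : ℕ) : ℤ) := by
        push_cast
        rw [← pow_add]
        congr 1
        omega
      have haz : a = ((2 ^ (M - c) : ℕ) : ℤ) • z := by
        apply hinj
        change ((2 ^ c : ℕ) : ℤ) • a = ((2 ^ c : ℕ) : ℤ) • (((2 ^ (M - c) : ℕ) : ℤ) • z)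
        rw [smul_smul, ← hpow, ← hfapply, ha, ← hz]
        rfl
      refine ⟨⟨f z, LinearMap.mem_range_self f z⟩, Subtype.ext ?_⟩
      change ((2 ^ (M - c) : ℕ) : ℤ) • f z = (x : A)
      rw [← ha, haz, hfapply, hfapply, smul_smul, smul_smul, mul_comm]
    · rintro ⟨y, rfl⟩
      obtain ⟨w, hw⟩ : ∃ w, f w = (y : A) := LinearMap.mem_range.mp y.2
      have hmem : (((((2 ^ (M - c) : ℕ) : ℤ)) • y : A') : A) ∈ δ.ker := by
        rw [hker, AddMonoidHom.mem_range]
        refine ⟨w, ?_⟩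
        change ((2 ^ M : ℕ) : ℤ) • w = ((2 ^ (M - c) : ℕ) : ℤ) • (y : A)
        rw [← hw, hfapply, smul_smul]
        congr 1
        push_cast
        rw [← pow_add]
        congr 1
        omega
      exact (AddMonoidHom.mem_ker).mp hmem
  have hrange : δ'.range ≤ zmultiples g := by
    rintro _ ⟨x, rfl⟩
    obtain ⟨a, ha⟩ : ∃ a, f a = (x : A) := LinearMap.mem_range.mp x.2
    rw [hδ'apply, ← ha, hfapply, map_zsmul]
    exact hcyc a
  -- counting
  haveI hfin : Finite (zmultiples g) := by
    have hg' : IsOfFinAddOrder g := by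
      rw [isOfFinAddOrder_iff_zsmul_eq_zero]
      exact ⟨((2 ^ M : ℕ) : ℤ), by positivity, hg⟩
    exact (finite_zmultiples (a := g)).mpr hg'
  have hcard1 : Nat.card (A' ⧸ (zsmulAddGroupHom (α := A') ((2 ^ (M - c) : ℕ) : ℤ)).range) = Nat.card δ'.range := by
    rw [← hkerδ']
    exact Nat.card_congr (QuotientAddGroup.quotientKerEquivRange δ').toEquiv
  have hcard2 : Nat.card δ'.range ∣ Nat.card (zmultiples g) := AddSubgroup.card_dvd_of_le hrange
  have hcard3 : Nat.card (zmultiples g) ∣ 2 ^ M := by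
    rw [Nat.card_zmultiples, addOrderOf_dvd_iff_nsmul_eq_zero, ← natCast_zsmul]
    exact hg
  have hfinal : (2 ^ (M - c)) ^ Module.finrank ℤ A ∣ 2 ^ M :=
    hdvd.trans (hcard1 ▸ hcard2.trans hcard3)
  rw [← pow_mul, Nat.pow_dvd_pow_iff_le_right (by norm_num)] at hfinal
  by_contra hr
  have h2r : (M - c) * 2 ≤ (M - c) * Module.finrank ℤ A := Nat.mul_le_mul_left _ (by omega)
  omega

end Rank

/-! ## §3 From the two exponent laws to the cyclic bound -/

section Laws

variable {V : Type*} [AddCommGroup V]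

/-- **The two exponent laws combine to a cyclic bound.**  `V` killed by `2^M`, `τ` an involution of `V` preserving a subgroup `Sel`,
`q ∈ Sel` an `ε`-eigenvector (`ε = ±1`) of maximal order `2^M`.  If (B) every `(−ε)`-eigenvector of `Sel` is killed by `2^c`, and (A) every
`ε`-eigenvector of `Sel` whose cyclic group meets `⟨q⟩` trivially is killed by `2^c`, then `2^{c+1} • Sel ⊆ ⟨q⟩`: write
`2v = (v + ετv) + (v − ετv)`, disjointify the first summand against `q` (`exists_sub_zsmul_disjoint_zmultiples`).
[cite: GrossLMS1991, §10 (Claims 10.1, 10.3 and the count over the two eigenspaces)] -/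
theorem zsmul_mem_zmultiples_of_exponent_laws {M : ℕ} (hV : ∀ v : V, ((2 ^ M : ℕ) : ℤ) • v = 0)
    (τ : V →+ V) (hττ : ∀ v, τ (τ v) = v) (Sel : AddSubgroup V) (hSel : ∀ v ∈ Sel, τ v ∈ Sel)
    {ε : ℤ} (hε : ε = 1 ∨ ε = -1) {q : V} (hq : q ∈ Sel) (hqord : addOrderOf q = 2 ^ M) (hτq : τ q = ε • q)
    {c : ℕ} (hB : ∀ s ∈ Sel, τ s = (-ε) • s → ((2 ^ c : ℕ) : ℤ) • s = 0)
    (hA : ∀ s ∈ Sel, τ s = ε • s → Disjoint (zmultiples s) (zmultiples q) → ((2 ^ c : ℕ) : ℤ) • s = 0) :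
    ∀ v ∈ Sel, ((2 ^ (c + 1) : ℕ) : ℤ) • v ∈ zmultiples q := by
  intro v hv
  have hε2 : ε * ε = 1 := by rcases hε with rfl | rfl <;> norm_num
  have hτv : τ v ∈ Sel := hSel v hv
  -- the two projections
  set sm := v - ε • τ v with hsm
  set sp := v + ε • τ v with hsp
  have hsmSel : sm ∈ Sel := Sel.sub_mem hv (Sel.zsmul_mem hτv ε)
  have hspSel : sp ∈ Sel := Sel.add_mem hv (Sel.zsmul_mem hτv ε)
  have hτsm : τ sm = (-ε) • sm := by
    rw [hsm, map_sub, map_zsmul, hττ, smul_sub, smul_smul, neg_mul, hε2, neg_smul, neg_smul, one_smul]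
    abel
  have hτsp : τ sp = ε • sp := by
    rw [hsp, map_add, map_zsmul, hττ, smul_add, smul_smul, hε2, one_smul, add_comm]
  -- (B) kills `sm`
  have hBm : ((2 ^ c : ℕ) : ℤ) • sm = 0 := hB sm hsmSel hτsm
  -- disjointify `sp` against `q`, then (A)
  obtain ⟨m, hdisj⟩ := exists_sub_zsmul_disjoint_zmultiples hV hqord sp
  have hsp'Sel : sp - m • q ∈ Sel := Sel.sub_mem hspSel (Sel.zsmul_mem hq m)
  have hτsp' : τ (sp - m • q) = ε • (sp - m • q) := by
    rw [map_sub, map_zsmul, hτsp, hτq, smul_sub, smul_comm ε m q]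
  have hAp : ((2 ^ c : ℕ) : ℤ) • (sp - m • q) = 0 := hA _ hsp'Sel hτsp' hdisj
  -- assemble: `2^(c+1) v = 2^c (sp + sm) = 2^c m • q`
  have h2v : sp + sm = (2 : ℤ) • v := by rw [hsp, hsm, two_smul]; abel
  have hpow : ((2 ^ (c + 1) : ℕ) : ℤ) = ((2 ^ c : ℕ) : ℤ) * 2 := by push_cast; ring
  rw [hpow, mul_smul, ← h2v, smul_add, hBm, add_zero]
  rw [smul_sub, sub_eq_zero, smul_smul] at hAp
  rw [hAp]
  exact zsmul_mem (mem_zmultiples q) _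

end Laws

end Summit.BirchSwinnertonDyer.BirchSwinnertonDyer.Theorems.GenusExact.PlusDescent
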